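import Summits.BirchSwinnertonDyer.Rank1Residual.Additive.GoodModelOfTypeG
import Summits.BirchSwinnertonDyer.Rank1Residual.Additive.InertiaKummerRootOfUnity
import Summits.BirchSwinnertonDyer.Rank1Residual.Additive.SubGordHigherOrdinary
import Mathlib.AlgebraicGeometry.EllipticCurve.NormalForms
import HarnessLib

/-!
# An EXPLICIT good model at a potentially good `p ≥ 5`: the Kummer–Deuring scaling
# `⟨u, r, s, t⟩`, `r s t ∈ ℚ`, `u^e = p^m` (`e` the semistability defect), fixed by `σ^e` for every
# local inertia element `σ`
# (cell `b2b-bsdres`, team n1011, seat p07 (gen 7); row T-ROL-EXP FILE A2)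

HONEST FRAMING (cell `b2b-bsdres`, run/shared/lean/b2b/bsd-rank1-residual/, verbatim in every
file): the goal of the cell is to DELETE the COMBINATION-SHAPED residual classes of the
Birch–Swinnerton-Dyer formula for ALL analytic-rank `≤ 1` elliptic curves over `ℚ` — "full BSD
formula for every rank `≤ 1` curve in class `C`" assembled STRICTLY from published theorems — so
that the rank-`≤ 1` remainder becomes exactly the CONSTRUCTION-SHAPED classes, which are TYPED
(missing-input `Prop`s), NOT attempted. This is not "finishing BSD". Team n1011 (N10/N11): research
route on the CONSTRUCTION-SHAPED classes X3♯(G-ord)/X4♯(G-ord); prove what is provable now; no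
claim beyond stated classes; census output = EVIDENCE, never a Literature fact; RESIDUAL-MAP marks
UNCHANGED; nothing is booked by this file. TOOL theorems only: NO definition, NO named fact, NO
conjecture node.

## What and why

p05's T-ROL-G (F-A/F-B/F-C) builds the ramified ordinary line of a (G-ord) row from ANY good model
`W₀ = C • E ⊗ K̄_v` over the valuation ring `𝒪_w` of `K̄_v` (Deuring's form, `C` from
`exists_variableChange_of_j_eq` — not explicit), and its clause "inertia acts on `E[p^∞]/C` through a
finite quotient" gets the exponent from the Krull topology (`exists_pos_forall_pow_smul_eq`), so the
exponent is not known. cc-typer-2's model-free line MATCHING (S3,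
`RamifiedOrdinaryLineMatchingModelFree`) needs it explicitly. This file supplies an EXPLICIT good model
whose change of variables is FIXED BY `σ^e` for every inertial `σ`, `e = semistabilityIndex W p` the
census's semistability defect `12 / gcd(12, ord_p Δ_min)`:

* short Weierstrass form over `ℚ` (Mathlib `toShortNF`, `u`-component `1`, so `c₄, c₆, Δ` unchanged),
  mapped to `K̄_v`, followed by the SCALING `⟨u, 0, 0, 0⟩` with `u ∈ K̄_v`, `u^e = p^m`,
  `m = ord_pΔ / gcd(12, ord_pΔ)` — so `|u|^{12} = |Δ|`, and `ord_p j ≥ 0` (`|c₄|³ ≤ |Δ|`, `|c₆|² ≤ |Δ|`)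
  makes `a₄/u⁴`, `a₆/u⁶` integral with UNIT discriminant `Δ/u^{12}` (Silverman *AEC* VII.5.5's
  computation);
* for `σ` in the local inertia group `σ^e(u) = u` (FILE A1 `pow_smul_eq_of_pow_eq_natCast_pow`:
  `ζ = σ(u)/u` is an `e`-th root of unity fixed by `σ`), and `r, s, t ∈ ℚ` are fixed by every `σ`.

Main: **`exists_kummerGoodModel`** — `∃ C W₀, C • E ⊗ K̄_v = W₀ ⊗ K̄_v ∧ IsUnit W₀.Δ ∧
∀ σ ∈ I_v, C.map (σ^e) = C`. FILE B of the row reads the exponent `e` off this model for EVERY ramified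
ordinary line (uniqueness). No class hypothesis, no named fact; `p ≥ 5`, `p ∈ v`, `ord_p j ≥ 0`,
`W` globally minimal.

References: J. H. Silverman, *AEC* 2nd ed. III.1, VII.5.5 [SilvermanAEC2009]; J.-P. Serre,
Invent. Math. 15 (1972) §5.6 p. 312 (`e = 12/gcd(12, v(Δ))`) [Serre1972]; J.-P. Serre, J. Tate, Ann.
of Math. 88 (1968) §2 [SerreTate1968]; cells/n1011/skel/T-ROL-EXP.md (67779f27699eb635); p05's
`Additive/GoodModelOfTypeG.lean` (valuation bookkeeping, consumed by name).
-/

set_option autoImplicit false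

noncomputable section

open scoped Classical NNReal NumberField

open WeierstrassCurve

universe u

namespace Summit.BirchSwinnertonDyer.Rank1Residual.Additive.GoodModelLine

open NumberField IsDedekindDomain Field IsDedekindDomain.HeightOneSpectrum
  Literature.NumberTheory.GaloisRepresentations Literature.NumberTheory.EllipticCurves
  Literature.NumberTheory.EllipticCurves.GreenbergSelmer
  Literature.NumberTheory.EllipticCurves.Rank1Residual
  Summit.BirchSwinnertonDyer.Rank1Residual.X2.GreenbergVatsalReductionDatum

section Local

variable (p : ℕ) [hp : Fact p.Prime] {v : HeightOneSpectrum (𝓞 ℚ)}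

/-! ## §2 Arithmetic of the semistability defect `e = 12 / gcd(12, ord_p Δ_min)` -/

variable (W : WeierstrassCurve ℚ) [W.IsElliptic] [W.IsGloballyMinimal]

omit hp [W.IsElliptic] in
/-- `e · gcd(12, ord_p Δ) = 12`. [folklore] -/
theorem semistabilityIndex_mul_gcd :
    semistabilityIndex W p * Nat.gcd 12 (padicValInt p W.minimalDiscriminantInt) = 12 :=
  Nat.div_mul_cancel (Nat.gcd_dvd_left _ _)

omit hp [W.IsElliptic] in
/-- `e ≠ 0`. [folklore] -/
theorem semistabilityIndex_ne_zero : semistabilityIndex W p ≠ 0 := by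
  intro h
  have := semistabilityIndex_mul_gcd p W
  rw [h, zero_mul] at this
  exact absurd this (by norm_num)

omit [W.IsElliptic] in
/-- For `p ≥ 5`: `p ∤ e` (as `e ∣ 12`). [folklore] -/
theorem not_dvd_semistabilityIndex (hp5 : 5 ≤ p) : ¬ p ∣ semistabilityIndex W p := by
  intro h
  have h12 : p ∣ 12 := dvd_trans h (semistabilityIndex_dvd_twelve W p)
  have hle : p ≤ 12 := Nat.le_of_dvd (by norm_num) h12
  interval_cases p <;> simp_all (config := {decide := true})

/-! ## §3 Valuation bookkeeping at `v ∋ p` for the coefficients of `E` -/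

omit [W.IsElliptic] [W.IsGloballyMinimal] in
/-- `|x|_v = 1` for a non-zero rational of `p`-adic valuation `0`. [folklore] -/
theorem specVal_algebraMap_eq_one_of_padicValRat_eq_zero (hpv : ((p : ℕ) : 𝓞 ℚ) ∈ v.asIdeal)
    {x : ℚ} (hx : x ≠ 0) (h0 : padicValRat p x = 0) :
    specVal v (algebraMap ℚ (AlgebraicClosure (v.adicCompletion ℚ)) x) = 1 := by
  have hle : specVal v (algebraMap ℚ (AlgebraicClosure (v.adicCompletion ℚ)) x) ≤ 1 :=
    (specVal_algebraMap_rat_iff (v := v) x).1.mpr ((valuation_le_one_iff_padicValRat p hpv hx).1.mpr h0.ge)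
  have hnlt : ¬ specVal v (algebraMap ℚ (AlgebraicClosure (v.adicCompletion ℚ)) x) < 1 := fun hlt ↦ by
    have := (valuation_le_one_iff_padicValRat p hpv hx).2.mp ((specVal_algebraMap_rat_iff (v := v) x).2.mp hlt)
    rw [h0] at this; exact lt_irrefl _ this
  exact le_antisymm hle (not_lt.mp hnlt)

omit [W.IsElliptic] [W.IsGloballyMinimal] in
/-- `|x|_v ≤ 1` for a rational of non-negative `p`-adic valuation (or `0`). [folklore] -/
theorem specVal_algebraMap_le_one_of_padicValRat_nonneg (hpv : ((p : ℕ) : 𝓞 ℚ) ∈ v.asIdeal)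
    {x : ℚ} (h0 : 0 ≤ padicValRat p x) :
    specVal v (algebraMap ℚ (AlgebraicClosure (v.adicCompletion ℚ)) x) ≤ 1 := by
  by_cases hx : x = 0
  · rw [hx, map_zero, map_zero]; exact zero_le_one
  · exact (specVal_algebraMap_rat_iff (v := v) x).1.mpr ((valuation_le_one_iff_padicValRat p hpv hx).1.mpr h0)

/-- **`|Δ|_v = |p|_v ^ ord_p(Δ_min)`** on a globally minimal model. [folklore] -/
theorem specVal_Δ_eq_pow (hpv : ((p : ℕ) : 𝓞 ℚ) ∈ v.asIdeal) :
    specVal v (algebraMap ℚ (AlgebraicClosure (v.adicCompletion ℚ)) W.Δ) =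
      specVal v ((p : ℕ) : AlgebraicClosure (v.adicCompletion ℚ)) ^
        padicValInt p W.minimalDiscriminantInt := by
  set L := AlgebraicClosure (v.adicCompletion ℚ)
  set n : ℕ := padicValInt p W.minimalDiscriminantInt with hn
  have hΔ0 : W.Δ ≠ 0 := W.isUnit_Δ.ne_zero
  have hp0 : (p : ℚ) ≠ 0 := Nat.cast_ne_zero.mpr hp.out.ne_zero
  have hval : padicValRat p W.Δ = n := by rw [hn, padicValRat_Δ_eq W p]
  have hx : padicValRat p (W.Δ / (p : ℚ) ^ n) = 0 := by
    rw [padicValRat.div hΔ0 (pow_ne_zero n hp0), padicValRat.pow, padicValRat.self hp.out.one_lt,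
      hval, mul_one, sub_self]
  have h1 := specVal_algebraMap_eq_one_of_padicValRat_eq_zero p hpv (div_ne_zero hΔ0 (pow_ne_zero n hp0)) hx
  have hsplit : algebraMap ℚ L W.Δ = algebraMap ℚ L (W.Δ / (p : ℚ) ^ n) * (p : L) ^ n := by
    rw [← map_natCast (algebraMap ℚ L) p, ← map_pow, ← map_mul, div_mul_cancel₀ _ (pow_ne_zero n hp0)]
  rw [hsplit, map_mul, h1, one_mul, map_pow]

omit [W.IsGloballyMinimal] in
/-- **`|c₄|_v³ ≤ |Δ|_v` when `ord_p j ≥ 0`** (`j = c₄³/Δ`). [folklore] -/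
theorem specVal_c₄_pow_three_le (hpv : ((p : ℕ) : 𝓞 ℚ) ∈ v.asIdeal) (hj : 0 ≤ padicValRat p W.j) :
    specVal v (algebraMap ℚ (AlgebraicClosure (v.adicCompletion ℚ)) W.c₄) ^ 3 ≤
      specVal v (algebraMap ℚ (AlgebraicClosure (v.adicCompletion ℚ)) W.Δ) := by
  set L := AlgebraicClosure (v.adicCompletion ℚ)
  have hΔ0 : W.Δ ≠ 0 := W.isUnit_Δ.ne_zero
  have hΔL : specVal v (algebraMap ℚ L W.Δ) ≠ 0 :=
    (Valuation.ne_zero_iff _).mpr ((map_ne_zero _).mpr hΔ0)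
  have hjeq : W.j = W.c₄ ^ 3 / W.Δ := by
    rw [WeierstrassCurve.j, Units.val_inv_eq_inv_val, coe_Δ', div_eq_mul_inv, mul_comm]
  have hjle : specVal v (algebraMap ℚ L W.j) ≤ 1 :=
    specVal_algebraMap_le_one_of_padicValRat_nonneg p hpv hj
  rw [hjeq, map_div₀, map_div₀, map_pow, map_pow, div_le_one (pos_iff_ne_zero.mpr hΔL)] at hjle
  exact hjle

omit [W.IsGloballyMinimal] in
/-- **`|c₆|_v² ≤ |Δ|_v` when `ord_p j ≥ 0`** (`c₆² = c₄³ − 1728Δ`). [folklore] -/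
theorem specVal_c₆_sq_le (hpv : ((p : ℕ) : 𝓞 ℚ) ∈ v.asIdeal) (hj : 0 ≤ padicValRat p W.j) :
    specVal v (algebraMap ℚ (AlgebraicClosure (v.adicCompletion ℚ)) W.c₆) ^ 2 ≤
      specVal v (algebraMap ℚ (AlgebraicClosure (v.adicCompletion ℚ)) W.Δ) := by
  set L := AlgebraicClosure (v.adicCompletion ℚ)
  have hrel : W.c₆ ^ 2 = W.c₄ ^ 3 - 1728 * W.Δ := by linear_combination W.c_relation
  have h1728 : specVal v (algebraMap ℚ L 1728) ≤ 1 := by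
    have := specVal_algebraMap_le_one_of_padicValRat_nonneg p hpv (x := ((1728 : ℕ) : ℚ))
      (by rw [← padicValRat_of_nat]; exact_mod_cast Nat.zero_le _)
    exact_mod_cast this
  calc specVal v (algebraMap ℚ L W.c₆) ^ 2 = specVal v (algebraMap ℚ L (W.c₄ ^ 3 - 1728 * W.Δ)) := by
        rw [← map_pow, ← map_pow, hrel]
    _ ≤ max (specVal v (algebraMap ℚ L (W.c₄ ^ 3))) (specVal v (algebraMap ℚ L (1728 * W.Δ))) := by
        rw [map_sub]; exact Valuation.map_sub _ _ _
    _ ≤ specVal v (algebraMap ℚ L W.Δ) := by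
        apply max_le
        · rw [map_pow, map_pow]; exact specVal_c₄_pow_three_le p W hpv hj
        · rw [map_mul, map_mul]
          calc specVal v (algebraMap ℚ L 1728) * specVal v (algebraMap ℚ L W.Δ)
              ≤ 1 * specVal v (algebraMap ℚ L W.Δ) := mul_le_mul' h1728 le_rfl
            _ = _ := one_mul _

/-! ## §4 The explicit Kummer–Deuring good model -/

/-- **THE KUMMER–DEURING GOOD MODEL.** `E/ℚ` globally minimal, `p ≥ 5`, `v ∋ p`, `ord_p j(E) ≥ 0`,
`e = semistabilityIndex W p = 12/gcd(12, ord_pΔ)`. There are a change of variables `C` over `K̄_v`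
and a Weierstrass equation `W₀` over the valuation ring `𝒪_w` of the spectral valuation with
`C • E ⊗ K̄_v = W₀ ⊗ K̄_v`, `Δ(W₀)` a UNIT, and `C` FIXED BY `σ^e` for every local inertia element
`σ`: `C = ⟨u, 0, 0, 0⟩ · (toShortNF E)`, `u^e = p^m`, `m = ord_pΔ/gcd(12, ord_pΔ)` (so `|u|^{12} = |Δ|`;
integrality of `a₄/u⁴`, `a₆/u⁶` from `|c₄|³ ≤ |Δ|`, `|c₆|² ≤ |Δ|`; `σ^e u = u` by
`pow_smul_eq_of_pow_eq_natCast_pow`). Silverman *AEC* VII.5.5 made explicit; the exponent `e` is the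
order of the image of inertia (Serre 1972 §5.6) — here only "`σ^e` fixes the model" is proved.
[cite: SilvermanAEC2009, Prop. VII.5.5] [cite: Serre1972, §5.6 (p. 312)] -/
theorem exists_kummerGoodModel (hp5 : 5 ≤ p) (hpv : ((p : ℕ) : 𝓞 ℚ) ∈ v.asIdeal)
    (hj : 0 ≤ padicValRat p W.j) :
    ∃ (C : VariableChange (AlgebraicClosure (v.adicCompletion ℚ)))
      (W₀ : WeierstrassCurve (specVal v).integer),
      C • (W.baseChange (v.adicCompletion ℚ)).baseChange (AlgebraicClosure (v.adicCompletion ℚ)) =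
        W₀.baseChange (AlgebraicClosure (v.adicCompletion ℚ)) ∧ IsUnit W₀.Δ ∧
      ∀ σ ∈ absInertia (v.adicCompletion ℚ),
        C.map ((absoluteGaloisGroup.toAlgEquiv _ (σ ^ semistabilityIndex W p) :
          AlgebraicClosure (v.adicCompletion ℚ) ≃ₐ[v.adicCompletion ℚ]
            AlgebraicClosure (v.adicCompletion ℚ)) :
          AlgebraicClosure (v.adicCompletion ℚ) →+* AlgebraicClosure (v.adicCompletion ℚ)) = C := by
  set L := AlgebraicClosure (v.adicCompletion ℚ)
  set w := specVal v with hw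
  set φ : ℚ →+* L := algebraMap ℚ L with hφ
  haveI : CharZero L := charZero_of_injective_algebraMap (algebraMap ℚ L).injective
  have hvO : w.Integers w.integer := Valuation.integer.integers _
  -- the exponent data
  set n : ℕ := padicValInt p W.minimalDiscriminantInt with hn
  set g : ℕ := Nat.gcd 12 n with hg
  set e : ℕ := semistabilityIndex W p with hedef
  set m : ℕ := n / g with hm
  have heg : e * g = 12 := semistabilityIndex_mul_gcd p W
  have hmg : m * g = n := Nat.div_mul_cancel (Nat.gcd_dvd_right _ _)
  have he0 : e ≠ 0 := semistabilityIndex_ne_zero p W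
  have hpe : ¬ p ∣ e := not_dvd_semistabilityIndex p W hp5
  -- the Kummer element `u`, `u ^ e = p ^ m`
  have hp0 : (p : L) ≠ 0 := Nat.cast_ne_zero.mpr hp.out.ne_zero
  obtain ⟨u, hu⟩ := IsAlgClosed.exists_pow_nat_eq ((p : L) ^ m) (Nat.pos_of_ne_zero he0)
  have hu0 : u ≠ 0 := by
    intro h; rw [h, zero_pow he0] at hu; exact pow_ne_zero m hp0 hu.symm
  -- valuations
  set q : ℝ≥0 := w (p : L) with hq
  have hwu : w u ^ e = q ^ m := by rw [← map_pow, hu, map_pow]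
  have hwu12 : w u ^ 12 = w (φ W.Δ) := by
    rw [hφ, specVal_Δ_eq_pow p W hpv, ← hn, ← hw, ← hq, ← heg, pow_mul, hwu, ← pow_mul, hmg]
  have hwu0 : w u ≠ 0 := (Valuation.ne_zero_iff _).mpr hu0
  have hc4 : w (φ W.c₄) ≤ w u ^ 4 := by
    have h := specVal_c₄_pow_three_le p W hpv hj
    rw [← hφ, ← hw, ← hwu12, show w u ^ 12 = (w u ^ 4) ^ 3 by ring] at h
    exact le_of_pow_le_pow_left₀ three_ne_zero (by positivity) h
  have hc6 : w (φ W.c₆) ≤ w u ^ 6 := by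
    have h := specVal_c₆_sq_le p W hpv hj
    rw [← hφ, ← hw, ← hwu12, show w u ^ 12 = (w u ^ 6) ^ 2 by ring] at h
    exact le_of_pow_le_pow_left₀ two_ne_zero (by positivity) h
  -- units `48`, `864` at `v` (`p ≥ 5`)
  have h2 : ¬ (p : ℤ) ∣ 2 := by
    intro h
    have := Int.le_of_dvd (by norm_num) h
    have : (p : ℤ) ≥ 5 := by exact_mod_cast hp5
    omega
  have h3 : ¬ (p : ℤ) ∣ 3 := by
    intro h
    have := Int.le_of_dvd (by norm_num) h
    have : (p : ℤ) ≥ 5 := by exact_mod_cast hp5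
    omega
  have hpZ : Prime (p : ℤ) := Nat.prime_iff_prime_int.mp hp.out
  have h48 : w (48 : L) = 1 := by
    have h : ¬ (p : ℤ) ∣ 48 := by
      intro hd
      rw [show (48 : ℤ) = 2 ^ 4 * 3 by norm_num] at hd
      rcases hpZ.dvd_or_dvd hd with hd | hd
      · exact h2 (hpZ.dvd_of_dvd_pow hd)
      · exact h3 hd
    have := spectralValuation_intCast_eq_one_of_natCast_mem hpv (specVal_spec v) (n := 48) h
    exact_mod_cast this
  have h864 : w (864 : L) = 1 := by
    have h : ¬ (p : ℤ) ∣ 864 := by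
      intro hd
      rw [show (864 : ℤ) = 2 ^ 5 * 3 ^ 3 by norm_num] at hd
      rcases hpZ.dvd_or_dvd hd with hd | hd
      · exact h2 (hpZ.dvd_of_dvd_pow hd)
      · exact h3 (hpZ.dvd_of_dvd_pow hd)
    have := spectralValuation_intCast_eq_one_of_natCast_mem hpv (specVal_spec v) (n := 864) h
    exact_mod_cast this
  -- the short normal form over `ℚ`
  haveI : Invertible (2 : ℚ) := invertibleOfNonzero two_ne_zero
  haveI : Invertible (3 : ℚ) := invertibleOfNonzero three_ne_zero
  set Cs : VariableChange ℚ := W.toShortNF with hCs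
  haveI hNF : (Cs • W).IsShortNF := W.toShortNF_spec
  have hCsu : Cs.u = 1 := by
    rw [hCs, WeierstrassCurve.toShortNF, VariableChange.mul_def]
    simp [WeierstrassCurve.toCharNeTwoNF]
  have hs_a₁ : (Cs • W).a₁ = 0 := a₁_of_isShortNF _
  have hs_a₂ : (Cs • W).a₂ = 0 := a₂_of_isShortNF _
  have hs_a₃ : (Cs • W).a₃ = 0 := a₃_of_isShortNF _
  have hs_c₄ : (Cs • W).c₄ = W.c₄ := by rw [variableChange_c₄, hCsu]; simp
  have hs_c₆ : (Cs • W).c₆ = W.c₆ := by rw [variableChange_c₆, hCsu]; simp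
  have hs_Δ : (Cs • W).Δ = W.Δ := by rw [variableChange_Δ, hCsu]; simp
  have ha₄ : (Cs • W).a₄ = -W.c₄ / 48 := by
    have h := c₄_of_isShortNF (Cs • W)
    rw [hs_c₄] at h
    field_simp
    linarith
  have ha₆ : (Cs • W).a₆ = -W.c₆ / 864 := by
    have h := c₆_of_isShortNF (Cs • W)
    rw [hs_c₆] at h
    field_simp
    linarith
  -- integrality of the scaled coefficients
  have hwsa₄ : w (φ (Cs • W).a₄) = w (φ W.c₄) := by
    rw [ha₄, map_div₀, map_neg, map_div₀, Valuation.map_neg, map_ofNat φ 48, h48,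
      div_one]
  have hwsa₆ : w (φ (Cs • W).a₆) = w (φ W.c₆) := by
    rw [ha₆, map_div₀, map_neg, map_div₀, Valuation.map_neg, map_ofNat φ 864, h864,
      div_one]
  have hwa₄ : w (u⁻¹ ^ 4 * φ (Cs • W).a₄) ≤ 1 := by
    rw [map_mul, map_pow, map_inv₀, hwsa₄]
    calc (w u)⁻¹ ^ 4 * w (φ W.c₄) ≤ (w u)⁻¹ ^ 4 * w u ^ 4 := mul_le_mul' le_rfl hc4
      _ = 1 := by rw [← mul_pow, inv_mul_cancel₀ hwu0, one_pow]
  have hwa₆ : w (u⁻¹ ^ 6 * φ (Cs • W).a₆) ≤ 1 := by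
    rw [map_mul, map_pow, map_inv₀, hwsa₆]
    calc (w u)⁻¹ ^ 6 * w (φ W.c₆) ≤ (w u)⁻¹ ^ 6 * w u ^ 6 := mul_le_mul' le_rfl hc6
      _ = 1 := by rw [← mul_pow, inv_mul_cancel₀ hwu0, one_pow]
  -- the model
  set Cu : VariableChange L := ⟨Units.mk0 u hu0, 0, 0, 0⟩ with hCu
  set C : VariableChange L := Cu * Cs.map φ with hC
  set W₀ : WeierstrassCurve w.integer :=
    ⟨0, 0, 0, ⟨u⁻¹ ^ 4 * φ (Cs • W).a₄, hwa₄⟩, ⟨u⁻¹ ^ 6 * φ (Cs • W).a₆, hwa₆⟩⟩ with hW₀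
  have hX : (W.baseChange (v.adicCompletion ℚ)).baseChange L = W.map φ := by
    rw [baseChange_baseChange_adicCompletion]; rfl
  have hCuu : ((Cu.u⁻¹ : Lˣ) : L) = u⁻¹ := by rw [hCu, Units.val_inv_eq_inv_val, Units.val_mk0]
  have hmodel : C • (W.baseChange (v.adicCompletion ℚ)).baseChange L = W₀.baseChange L := by
    rw [hX, hC, mul_smul, map_variableChange]
    ext
    · simp [variableChange_a₁, hCu, hW₀]
    · simp [variableChange_a₂, hCu, hW₀]
    · simp [variableChange_a₃, hCu, hW₀]
    · rw [variableChange_a₄, hCuu]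
      simp [hCu, hW₀]
      rfl
    · rw [variableChange_a₆, hCuu]
      simp [hCu, hW₀]
      rfl
  refine ⟨C, W₀, hmodel, ?_, fun σ hσ ↦ ?_⟩
  · -- unit discriminant: `Δ(W₀) = Δ/u^{12}`, `|u|^{12} = |Δ|`
    apply hvO.isUnit_of_one
    · exact isUnit_iff_ne_zero.mpr (by
        intro h0
        have h : (W₀.baseChange L).Δ = 0 := by rw [baseChange, map_Δ]; exact h0
        rw [← hmodel, variableChange_Δ, hX, map_Δ] at h
        exact (mul_ne_zero (pow_ne_zero _ (Units.ne_zero _)) ((map_ne_zero φ).mpr W.isUnit_Δ.ne_zero)) h)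
    · have hCval : ((C.u⁻¹ : Lˣ) : L) = u⁻¹ := by
        rw [Units.val_inv_eq_inv_val, hC, VariableChange.mul_def]
        simp [hCu, hCsu]
      have h : w (W₀.baseChange L).Δ = 1 := by
        rw [← hmodel, variableChange_Δ, hX, map_Δ, hCval, map_mul, map_pow, map_inv₀, ← hwu12, ← mul_pow,
          inv_mul_cancel₀ hwu0, one_pow]
      rw [baseChange, map_Δ] at h
      exact h
  · -- `σ^e` fixes `C`: `u` by Kummer, `r, s, t ∈ ℚ` always
    set τ := σ ^ e with hτ
    set ψ : L ≃ₐ[v.adicCompletion ℚ] L := absoluteGaloisGroup.toAlgEquiv _ τ with hψ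
    have hψu : ψ u = u := by
      rw [hψ, ← absoluteGaloisGroup.smul_def, hτ]
      exact pow_smul_eq_of_pow_eq_natCast_pow p hpv he0 hpe hu hσ
    have hψφ : (ψ : L →+* L).comp φ = φ := Subsingleton.elim _ _
    have hCs' : (Cs.map φ).map (ψ : L →+* L) = Cs.map φ := by
      rw [VariableChange.map_map, hψφ]
    have hCu' : Cu.map (ψ : L →+* L) = Cu := by
      rw [hCu]
      ext
      · simp [VariableChange.map, hψu]
      · simp [VariableChange.map]
      · simp [VariableChange.map]
      · simp [VariableChange.map]
    rw [hC, show (Cu * Cs.map φ).map (ψ : L →+* L) = Cu.map (ψ : L →+* L) * (Cs.map φ).map (ψ : L →+* L)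
      from map_mul (VariableChange.mapHom (ψ : L →+* L)) Cu (Cs.map φ), hCu', hCs']

end Local

end Summit.BirchSwinnertonDyer.Rank1Residual.Additive.GoodModelLine

end
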